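import Summits.BirchSwinnertonDyer.BirchSwinnertonDyer.Theorems.PrintCf2RubinValueTwoColemanCoinvariantCharTraceEllipticUnits
import Literature.NumberTheory.NumberFields.RayClassFieldTwoVariableTowerData
import HarnessLib

/-!
# Brick (c) at `p = 2`, local `χ`-part ON THE `ℤ/d`-TRACE, FOR THE ELLIPTIC UNITS — THE LOCAL TOWER DATA DISCHARGED FROM ONE GLOBAL ELEMENT,
# FOR A TOWER OF ARBITRARY DEGREE `d·p^m`: `char_Λ ((N_Σ / Col_Σ 𝒞̄_ell)_ε) = (L_ε)` for `𝔤 = 𝔤₀v'^ν`, `α_i = α^{p^{i+1}}`, `c = 1`, given ONE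
# `α ≡ 1 mod 𝔤₀`, `(α) = 𝔭_v^f`, of `v'`-level `ℓ` with `α^p` of exact level `ν + 1`, an unramified tower `E_j` of degree `d·p^j`, `f ∣ d ∣ ord Frob_v`

Cell `bsd-print-cf2`, width seat `bsd-line-cf2c-w7` g17, route C `PrintCf2RubinValueTwo`, crux of record stmt-BirchSwinnertonDyer-24033
`TwoVariableMainConjAtSplitTwoQuad` (23720 nominal), BRICK §4(c); `--supports` the crux as a helper.  THEOREMS ONLY (0 sorry, no named fact
asserted, no definition); CONDITIONAL on the published named facts `DeShalit1987.prop24_ii/iii`, `prop25_i` carried as hypotheses by the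
elliptic-unit files.  Theses-free.  BSD is not proved by any of this.

This is g16's S41 (`…ellipticUnits_towerData_eq_span`, review-revised because its parent S36 carried `[Unique (ZMod d)]`, forcing `f ∣ d = 1` —
vacuous for `K = ℚ(√−7)`, finding F6) RE-FILED ON THE `ℤ/d`-TRACE: the parent is now
`ColemanCoinvariantTraceEllipticUnits.charIdeal_coinvariants_colemanImageTrace_closure_ellipticUnits_liftable_eq_span` (any `d`), and the LOCAL TOWER
DATA binders `hw / hα0 / hα𝔪 / hαw / hαπ / hdegEc / hinert₀ / hcount` are the theorems `hw_of_towerData`, `towerData_*` of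
`RayClassFieldTwoVariableTowerData` (S40):

* ★★★ **`charIdeal_coinvariants_colemanImageTrace_closure_ellipticUnits_towerData_eq_span`** — the local (c)-identity on the trace for the elliptic
  units indexed by the liftable ideals of the tower `𝔤 := 𝔤₀·v'^ν` (`c = 1`, `α_i = α^{p^{i+1}}`, `f_i = f·p^{i+1}`), from: `𝔤₀ ≠ 0` with `v, v' ∤ 𝔤₀`,
  `w_{𝔤₀} = 1`; `v'` of degree one, absolutely unramified over `p`; ONE `α ≠ 0`, `α ≡ 1 mod 𝔤₀`, `(α) = 𝔭_v^f`, `α = π^f` in `K_v`, of `v'`-level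
  `ℓ ≥ 1` with `α^p` of exact level `ν + 1` (`ν + 1 ≥ 2` or `p ≠ 2`); the unramified tower `E_j` of the Coleman frame (degree `d·p^j`, ANY `d`
  prime to `p`) with `f ∣ d`, `d ∣ ord Frob_v(K(𝔤₀)/K)`; plus the Coleman-side frame, theta families, lifts `σ̃_a`, (A) `a₁/a₂`, (L).
  For `K = ℚ(√−7)`: `𝔤₀ = 𝔣 = (√−7)`, `α = π³`, `f = d = 3`, `ℓ = 1`, `ν = 2` (`𝔤 = 𝔣v̄²`, `c = 1`) — ADMISSIBLE now.

## References
* [deShalit1987] E. de Shalit, *Iwasawa theory of elliptic curves with complex multiplication* (1987), II §1.9, §1.10, §2.4 (ii), §4.12, §4.14,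
  §4.17; III §1.3, §1.4 (5), Lemma 1.10 (17).
* [Serre1973CourseArithmetic] J.-P. Serre, *A Course in Arithmetic* (1973), Ch. II §3.1.
* [NeukirchANT1999] J. Neukirch, *Algebraic Number Theory* (1999), Ch. VI §5 Prop. (5.6), §7 Thm. (7.1), Cor. (7.3).
-/

noncomputable section

set_option linter.dupNamespace false
set_option autoImplicit false

open Filter Topology
open scoped PowerSeries.WithPiTopology
open scoped NumberField Classical

namespace Summit.BirchSwinnertonDyer.BirchSwinnertonDyer.Theorems.PrintCf2.ColemanCoinvariantTraceEllipticUnitsTowerData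

open Field IsDedekindDomain IsDedekindDomain.HeightOneSpectrum ValuativeRel WithZero
open Literature.NumberTheory.NumberFields
open Literature.NumberTheory.GaloisRepresentations Literature.NumberTheory.GaloisRepresentations.IsNonarchimedeanLocalField
  Literature.NumberTheory.GaloisRepresentations.LubinTate Literature.NumberTheory.GaloisRepresentations.ArtinLocalGlobal
open Literature.NumberTheory.EllipticCurves
open Literature.NumberTheory.ComplexMultiplication.EllipticUnits
open Literature.NumberTheory.LFunctions.AbelianDensity (artinSymbol)
open Literature.RingTheory.PowerSeries (maxEval)
open Summit.BirchSwinnertonDyer.BirchSwinnertonDyer.Theorems.PrintCf2.ColemanImage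
open Summit.BirchSwinnertonDyer.BirchSwinnertonDyer.Theorems.PrintCf2.ColemanCoinvariantGalois
open Summit.BirchSwinnertonDyer.BirchSwinnertonDyer.Theorems.PrintCf2.ColemanCoinvariantArtin
open Summit.BirchSwinnertonDyer.BirchSwinnertonDyer.Theorems.PrintCf2.EllipticUnitsLocal
open Summit.BirchSwinnertonDyer.BirchSwinnertonDyer.Theorems.PrintCf2.EllipticUnitsLocal₂
open Summit.BirchSwinnertonDyer.BirchSwinnertonDyer.Theorems.PrintCf2.ColemanCoinvariantEllipticUnits
open Summit.BirchSwinnertonDyer.BirchSwinnertonDyer.Theorems.PrintCf2.ColemanCoinvariantEllipticUnitsLiftable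
open Summit.BirchSwinnertonDyer.BirchSwinnertonDyer.Theorems.PrintCf2.ColemanCoinvariantTrace
open Summit.BirchSwinnertonDyer.BirchSwinnertonDyer.Theorems.PrintCf2.ColemanCoinvariantTraceEllipticUnits

variable {K : Type} [Field K] [NumberField K] {𝔤₀ : Ideal (𝓞 K)} {v v' : HeightOneSpectrum (𝓞 K)}

attribute [local instance] ltNormUniformSpace ltNormIsUniformAddGroup rk1 nF nE fintypeResidueField
attribute [local instance] RelNormCoherentUnits.instCommMonoid

/-- `v ∤ 𝔤₀v'^ν` for `v ∤ 𝔤₀`, `v ≠ v'`. [cite: deShalit1987, II.4.14 (p. 71)] -/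
private theorem not_mul_pow_le₂₀ (hv : ¬ 𝔤₀ ≤ v.asIdeal) (hvv' : v' ≠ v) (n : ℕ) : ¬ 𝔤₀ * v'.asIdeal ^ n ≤ v.asIdeal := by
  intro h
  rcases (v.isPrime.mul_le).mp h with h1 | h2
  · exact hv h1
  · rcases n with _ | n
    · rw [pow_zero, Ideal.one_eq_top, top_le_iff] at h2
      exact v.isPrime.ne_top h2
    · exact hvv' (HeightOneSpectrum.ext ((v'.isMaximal.eq_of_le v.isPrime.ne_top ((Ideal.IsPrime.pow_le_iff (hP := v.isPrime)
        (Nat.succ_ne_zero n)).mp h2))))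

/-! ## The (c)-identity with the tower data supplied by `RayClassFieldTwoVariableTowerData` -/

section Capstone

attribute [local instance] isAdicComplete_maximalIdeal_powerSeries_integer

variable [NumberField.IsTotallyComplex K]
  (h24iii : DeShalit1987.prop24_iii_unit) (h25 : DeShalit1987.prop25_i_normRelation) (h24ii : DeShalit1987.prop24_ii_galoisAction)
  (hK : IsImaginaryQuadratic K) (ιK : K →+* ℂ)
  -- the global data: `𝔤₀`, the auxiliary prime `v'` (degree one, absolutely unramified over `p`), ONE element `α`
  (h𝔤0 : 𝔤₀ ≠ ⊥) (hv : ¬ 𝔤₀ ≤ v.asIdeal) (hv' : ¬ 𝔤₀ ≤ v'.asIdeal) (hvv' : v' ≠ v)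
  (hw𝔤 : ∀ u : (𝓞 K)ˣ, (u : 𝓞 K) - 1 ∈ 𝔤₀ → u = 1)
  {p : ℕ} [hp : Fact p.Prime] (hdeg1 : Nat.card (𝓞 K ⧸ v'.asIdeal) = p) (hpv' : (p : 𝓞 K) ∈ v'.asIdeal) (hpv'2 : (p : 𝓞 K) ∉ v'.asIdeal ^ 2)
  {π : 𝒪[v.adicCompletion K]} (hπ : (valuation (v.adicCompletion K)).IsUniformizer (π : v.adicCompletion K))
  {α : 𝓞 K} (hα0 : α ≠ 0) (hα𝔤 : α - 1 ∈ 𝔤₀) (hαw : ∀ w : HeightOneSpectrum (𝓞 K), w ≠ v → α ∉ w.asIdeal)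
  {f : ℕ} (hαf : Ideal.span {α} = v.asIdeal ^ f) (hαπ : ((α : K) : v.adicCompletion K) = (π : v.adicCompletion K) ^ f)
  {ℓ ν : ℕ} (hℓ : 1 ≤ ℓ) (hαℓ : v'.intValuation (α - 1) = exp (-(ℓ : ℤ)))
  (ha2 : 2 ≤ ν + 1 ∨ p ≠ 2) (hαa : v'.intValuation (α ^ p - 1) = exp (-((ν + 1 : ℕ) : ℤ)))
  [CharZero (v.adicCompletion K)]
  -- the local two-variable frame of the (c)-chain
  {d : ℕ} (hd : d.Coprime p) (hfd : f ∣ d)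
  (E : ℕ → IntermediateField (v.adicCompletion K) (AlgebraicClosure (v.adicCompletion K)))
  [∀ j, FiniteDimensional (v.adicCompletion K) (E j)] [∀ j, Normal (v.adicCompletion K) (E j)] [∀ j, IsGalois (v.adicCompletion K) (E j)]
  (hmono : Monotone E) (hE : ∀ j, E j ≤ maxUnramified (v.adicCompletion K)) (hdeg : ∀ j, Module.finrank (v.adicCompletion K) (E j) = d * p ^ j)
  (hdvd : d ∣ orderOf (galFrob K (rayClassField K 𝔤₀) v))
  {σ₀ : absoluteGaloisGroup (v.adicCompletion K)} (hσ₀ : IsAbsArithFrob σ₀) (hq : residueFieldCard (v.adicCompletion K) = 2)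
  (u : (LTCoeff (v.adicCompletion K))ˣ) (hu : LTCoeff.of (v.adicCompletion K) π = residueFieldCard (v.adicCompletion K) * u)
  (γ w : 𝒪[v.adicCompletion K]ˣ) (hγ : (γ : 𝒪[v.adicCompletion K]) = 1 + π ^ 2 * w)
  [IsAdicComplete (Ideal.span {intBase (v.adicCompletion K) (LTCoeff.of (v.adicCompletion K) π)}) (PowerSeries 𝒪[v.adicCompletion K])]
  [NeZero d]
  {θ : ∀ j, unitBall (E j)} (hθ : ∀ j, IsIntegralNormalGen (E j) (θ j))
  (hcoh : ∀ j, unitBallTrace (hmono (Nat.le_succ j)) (θ (j + 1)) = θ j)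
  [IsAdicComplete (Ideal.span {(p : 𝒪[v.adicCompletion K])}) 𝒪[v.adicCompletion K]]
  (hI : Ideal.span {(p : 𝒪[v.adicCompletion K])} ≠ ⊤)
  (hud : ∀ j, (u : LTCoeff (v.adicCompletion K)) ^ Module.finrank (v.adicCompletion K) (E j) ≠ 1)
  (hm : ∃ m₁ : ℕ, LTCoeff.of (v.adicCompletion K) π ^ 2 ∣ LTCoeff.of (v.adicCompletion K) π - m₁)
  (hN : DenseRange (Nat.cast : ℕ → 𝒪[v.adicCompletion K]))
  -- theta families and local lifts indexed by the liftable ideals of the tower `𝔤 = 𝔤₀v'^ν`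
  (x : ∀ a : {𝔞 : Ideal (𝓞 K) // IsLocArtinLiftable (𝔤₀ * v'.asIdeal ^ ν) v v' 𝔞}, ∀ i k : ℕ,
    rayClassField K (𝔤₀ * v'.asIdeal ^ ν * v'.asIdeal ^ (i + 1) * v.asIdeal ^ (k + 1)))
  (hx : ∀ a, ∀ i k : ℕ, IsThetaValueOne ιK (𝔤₀ * v'.asIdeal ^ ν * v'.asIdeal ^ (i + 1) * v.asIdeal ^ (k + 1)) (a.1 : Ideal (𝓞 K))
    (algClosureEmb ιK ((x a i k : rayClassField K (𝔤₀ * v'.asIdeal ^ ν * v'.asIdeal ^ (i + 1) * v.asIdeal ^ (k + 1))) : AlgebraicClosure K)))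
  (σ : {𝔞 : Ideal (𝓞 K) // IsLocArtinLiftable (𝔤₀ * v'.asIdeal ^ ν) v v' 𝔞} → absoluteGaloisGroup (v.adicCompletion K))
  (hσ : ∀ a, ∀ i k : ℕ, absRestrictNormalHom (rayClassField K (𝔤₀ * v'.asIdeal ^ ν * v'.asIdeal ^ (i + 1) * v.asIdeal ^ (k + 1)))
      (absGaloisRestrict K (v.adicCompletion K) (σ a)) =
    artinSymbol (galFrob K (rayClassField K (𝔤₀ * v'.asIdeal ^ ν * v'.asIdeal ^ (i + 1) * v.asIdeal ^ (k + 1)))) (a.1 : Ideal (𝓞 K)))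
  (ε : PowerSeries (PowerSeries 𝒪[v.adicCompletion K]))
  (g : {𝔞 : Ideal (𝓞 K) // IsLocArtinLiftable (𝔤₀ * v'.asIdeal ^ ν) v v' 𝔞} → (PowerSeries 𝒪[v.adicCompletion K])ˣ)

include h24ii hσ hm hmono hℓ hαℓ hαf hdvd in
/-- ★★★ **THE LOCAL (c)-IDENTITY FOR THE ELLIPTIC UNITS ON THE `ℤ/d`-TRACE WITH THE TOWER DATA DISCHARGED FROM ONE GLOBAL ELEMENT**: for the tower
`𝔤 = 𝔤₀v'^ν` (`c = 1`, `α_i = α^{p^{i+1}}`, `f_i = f·p^{i+1}`) the binders `hw / hα0 / hα𝔪 / hαw / hαπ / hdegEc / hinert₀ / hcount` of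
`…colemanImageTrace_closure_ellipticUnits_liftable_eq_span` are the theorems `hw_of_towerData`, `towerData_*` of `RayClassFieldTwoVariableTowerData`; what is assumed about
the global side is only: `𝔤₀ ≠ 0`, `v, v' ∤ 𝔤₀`, `w_{𝔤₀} = 1`, `v'` of degree one absolutely unramified, ONE `α` (`≠ 0`, `≡ 1 mod 𝔤₀`, `(α) = 𝔭_v^f`,
`α = π^f`, `v'`-level `ℓ ≥ 1`, `α^p` of exact level `ν + 1`), `f ∣ d ∣ ord Frob_v(K(𝔤₀))`.  Conclusion: **`char_Λ ((N_Σ / Col_Σ 𝒞̄_ell)_ε) = (L_ε)`** (on the `ℤ/d`-trace, any `d` prime to `p`).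
[cite: deShalit1987, II §1.9, §1.10, §2.4 (ii), §4.12 (33), §4.14, §4.17; III §1.3, §1.4 (5), Lemma 1.10 (17)]
[cite: Serre1973CourseArithmetic, Ch. II §3.1] [cite: NeukirchANT1999, Ch. VI §5 Prop. (5.6), §7 Thm. (7.1)] -/
theorem charIdeal_coinvariants_colemanImageTrace_closure_ellipticUnits_towerData_eq_span (hε : ε * ε = 1)
    (a₁ a₂ : {𝔞 : Ideal (𝓞 K) // IsLocArtinLiftable (𝔤₀ * v'.asIdeal ^ ν) v v' 𝔞}) (hv₁ : lubinTateChar hπ (σ a₁) = γ)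
    (hn₁ : ((Ideal.absNorm (a₁.1 : Ideal (𝓞 K)) : ℕ) : PowerSeries 𝒪[v.adicCompletion K]) * ((g a₁)⁻¹ : (PowerSeries 𝒪[v.adicCompletion K])ˣ) - 1 ∈
      IsLocalRing.maximalIdeal (PowerSeries 𝒪[v.adicCompletion K]))
    (ha₂ : maxEval hn₁ (colemanDeltaCoinvFun hπ hq (intBase (v.adicCompletion K)) u hu γ (eq_zero_of_C_pi_mul_eq_zero_integer hπ) w hγ ε
        (unitTwistₗ hπ hq (intBase (v.adicCompletion K)) u hu γ (lubinTateChar hπ (σ a₂)) (TActModule.ofPS _ _ 1)) -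
      PowerSeries.C (((Ideal.absNorm (a₂.1 : Ideal (𝓞 K)) : ℕ) : PowerSeries 𝒪[v.adicCompletion K]) *
        ((g a₂)⁻¹ : (PowerSeries 𝒪[v.adicCompletion K])ˣ))) ≠ 0)
    (L : PowerSeries (PowerSeries 𝒪[v.adicCompletion K])) (hL0 : L ≠ 0)
    (hL : ∀ b : {𝔞 : Ideal (𝓞 K) // IsLocArtinLiftable (𝔤₀ * v'.asIdeal ^ ν) v v' 𝔞}, colemanDeltaCoinvFun hπ hq (intBase (v.adicCompletion K)) u hu γ (eq_zero_of_C_pi_mul_eq_zero_integer hπ) w hγ ε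
        (indexTraceₗ hπ hq u hu γ (colemanImage hd hπ E hmono hE hdeg hσ₀ hq u hu γ hθ hcoh
          (closure_unitsGen_subset_principalCoherentFamilies hπ E hmono
            (fun b ↦ ellipticUnitsPrincipal₂ h24iii h25 hK ιK
                (mul_ne_zero h𝔤0 (pow_ne_zero ν v'.ne_bot))
                (not_mul_pow_le₂₀ hv hvv' ν) hvv'
                (hw_of_towerData hw𝔤) hπ
                (towerData_hα0 (p := p) hα0)
                (towerData_hα𝔪 hv' hp.out hpv' hpv'2 hα𝔤 ha2 hαa)
                (towerData_hαw (p := p) hαw)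
                (towerData_hαπ (p := p) hαπ) E hmono 1 (fun i ↦ hE (i + 1))
                (towerData_hdegE hfd E hE hdeg)
              b.2.1 b.2.2.1 (x b) (hx b))
            (fun b ↦ ellipticUnitsPrincipal₂_mem_principalCoherentFamilies h24iii h25 hK ιK
                (mul_ne_zero h𝔤0 (pow_ne_zero ν v'.ne_bot))
                (not_mul_pow_le₂₀ hv hvv' ν) hvv'
                (hw_of_towerData hw𝔤) hπ
                (towerData_hα0 (p := p) hα0)
                (towerData_hα𝔪 hv' hp.out hpv' hpv'2 hα𝔤 ha2 hαa)
                (towerData_hαw (p := p) hαw)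
                (towerData_hαπ (p := p) hαπ) E hmono 1
              (fun i ↦ hE (i + 1))
                  (towerData_hdegE hfd E hE hdeg) b.2.1 b.2.2.1 (fun i ↦
                  (towerData_hinert h𝔤0 hv hv' hvv' hw𝔤 hp.out hpv' hpv'2 hπ hα0 hα𝔤 hαf hℓ hαℓ ha2 hαa hd hdvd E hE hdeg) (i + 1))
                  (towerData_hcount h𝔤0 hv' hvv' hw𝔤 hp.out hdeg1 hpv' hpv'2 E hdeg) (x b) (hx b))
            (mem_closure_unitsGen hπ E _ b)).1)) =
      (colemanDeltaCoinvFun hπ hq (intBase (v.adicCompletion K)) u hu γ (eq_zero_of_C_pi_mul_eq_zero_integer hπ) w hγ ε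
          (unitTwistₗ hπ hq (intBase (v.adicCompletion K)) u hu γ (lubinTateChar hπ (σ b)) (TActModule.ofPS _ _ 1)) *
          PowerSeries.C (g b : PowerSeries 𝒪[v.adicCompletion K]) - PowerSeries.C ((Ideal.absNorm (b.1 : Ideal (𝓞 K)) : ℕ) : PowerSeries 𝒪[v.adicCompletion K])) * L) :
    Module.charIdeal (PowerSeries (PowerSeries 𝒪[v.adicCompletion K]))
        (↥(unitsImageTrace hd hπ E hmono hE hdeg hσ₀ hq u hu γ hθ hcoh hI hud) ⧸
          colemanCoinvRel hπ hq (intBase (v.adicCompletion K)) u hu γ ε (unitsImageTrace hd hπ E hmono hE hdeg hσ₀ hq u hu γ hθ hcoh hI hud)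
            (fun _ hG => unitTwistₗ_mem_unitsImageTrace hd hπ E hmono hE hdeg hσ₀ hq u hu γ hθ hcoh hI hud (-1) hG)
            (colemanImageTrace hd hπ E hmono hE hdeg hσ₀ hq u hu γ hθ hcoh hN
              (closure (Submonoid.closure
                (Set.range (fun b ↦ ellipticUnitsPrincipal₂ h24iii h25 hK ιK
                    (mul_ne_zero h𝔤0 (pow_ne_zero ν v'.ne_bot))
                    (not_mul_pow_le₂₀ hv hvv' ν) hvv'
                    (hw_of_towerData hw𝔤) hπ
                    (towerData_hα0 (p := p) hα0)
                    (towerData_hα𝔪 hv' hp.out hpv' hpv'2 hα𝔤 ha2 hαa)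
                    (towerData_hαw (p := p) hαw)
                    (towerData_hαπ (p := p) hαπ) E hmono 1 (fun i ↦ hE (i + 1))
                  (towerData_hdegE hfd E hE hdeg) b.2.1 b.2.2.1 (x b) (hx b)) ∪
                  Set.range fun b ↦ fun j ↦ (ellipticUnitsPrincipal₂ h24iii h25 hK ιK
                      (mul_ne_zero h𝔤0 (pow_ne_zero ν v'.ne_bot))
                      (not_mul_pow_le₂₀ hv hvv' ν) hvv'
                      (hw_of_towerData hw𝔤) hπ
                      (towerData_hα0 (p := p) hα0)
                      (towerData_hα𝔪 hv' hp.out hpv' hpv'2 hα𝔤 ha2 hαa)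
                      (towerData_hαw (p := p) hαw)
                      (towerData_hαπ (p := p) hαπ) E hmono 1
                    (fun i ↦ hE (i + 1)) (towerData_hdegE hfd E hE hdeg) b.2.1 b.2.2.1 (x b) (hx b) j).inv hπ (E j)) :
                Set (∀ j, RelNormCoherentUnits hπ (E j))))
              isClosed_closure
              (closure_unitsGen_subset_principalCoherentFamilies hπ E hmono _
                (fun b ↦ ellipticUnitsPrincipal₂_mem_principalCoherentFamilies h24iii h25 hK ιK
                    (mul_ne_zero h𝔤0 (pow_ne_zero ν v'.ne_bot))
                    (not_mul_pow_le₂₀ hv hvv' ν) hvv'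
                    (hw_of_towerData hw𝔤) hπ
                    (towerData_hα0 (p := p) hα0)
                    (towerData_hα𝔪 hv' hp.out hpv' hpv'2 hα𝔤 ha2 hαa)
                    (towerData_hαw (p := p) hαw)
                    (towerData_hαπ (p := p) hαπ) E hmono 1
                  (fun i ↦ hE (i + 1))
                      (towerData_hdegE hfd E hE hdeg) b.2.1 b.2.2.1 (fun i ↦
                      (towerData_hinert h𝔤0 hv hv' hvv' hw𝔤 hp.out hpv' hpv'2 hπ hα0 hα𝔤 hαf hℓ hαℓ ha2 hαa hd hdvd E hE hdeg) (i + 1))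
                      (towerData_hcount h𝔤0 hv' hvv' hw𝔤 hp.out hdeg1 hpv' hpv'2 E hdeg) (x b) (hx b)))
              (one_mem_closure_unitsGen hπ E _) (mul_mem_closure_unitsGen hπ E _) (inv_mem_closure_unitsGen hπ E _)
              (galAct_mem_closure_unitsGen hπ E _ (galAct_mem_closure_unitsGen_of_mul_rule hπ E hmono _ σ
                (happrox_of_isLocArtinLiftable
                    (mul_ne_zero h𝔤0 (pow_ne_zero ν v'.ne_bot))
                    (not_mul_pow_le₂₀ hv hvv' ν) hvv'
                    (hw_of_towerData hw𝔤) hπ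
                    (towerData_hα0 (p := p) hα0)
                    (towerData_hα𝔪 hv' hp.out hpv' hpv'2 hα𝔤 ha2 hαa)
                    (towerData_hαw (p := p) hαw)
                    (towerData_hαπ (p := p) hαπ) E hmono hE 1
                    (towerData_hdegE hfd E hE hdeg)
                    (towerData_hinert h𝔤0 hv hv' hvv' hw𝔤 hp.out hpv' hpv'2 hπ hα0 hα𝔤 hαf hℓ hαℓ ha2 hαa hd hdvd E hE hdeg)
                    (towerData_hcount h𝔤0 hv' hvv' hw𝔤 hp.out hdeg1 hpv' hpv'2 E hdeg) σ hσ)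
                (fun a b ↦ ⟨a.1 * b.1, a.2.mul b.2⟩)
                (fun b ↦ Ideal.absNorm (b.1 : Ideal (𝓞 K)))
                (hrule_ellipticUnitsPrincipal₂ h24iii h25 hK ιK
                    (mul_ne_zero h𝔤0 (pow_ne_zero ν v'.ne_bot))
                    (not_mul_pow_le₂₀ hv hvv' ν) hvv'
                    (hw_of_towerData hw𝔤) hπ
                    (towerData_hα0 (p := p) hα0)
                    (towerData_hα𝔪 hv' hp.out hpv' hpv'2 hα𝔤 ha2 hαa)
                    (towerData_hαw (p := p) hαw)
                    (towerData_hαπ (p := p) hαπ) E hmono 1 (fun i ↦ hE (i + 1))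
                    (towerData_hdegE hfd E hE hdeg) h24ii
                  Subtype.val (fun a b ↦ ⟨a.1 * b.1, a.2.mul b.2⟩) (fun _ _ ↦ rfl) (fun a ↦ a.2.1) (fun a ↦ a.2.2.1) x hx σ hσ))))) =
      Ideal.span {L} :=
  charIdeal_coinvariants_colemanImageTrace_closure_ellipticUnits_liftable_eq_span h24iii h25 h24ii hK ιK (mul_ne_zero h𝔤0 (pow_ne_zero ν v'.ne_bot))
    (not_mul_pow_le₂₀ hv hvv' ν) hvv' (hw_of_towerData hw𝔤) hπ (towerData_hα0 (p := p) hα0)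
    (towerData_hα𝔪 hv' hp.out hpv' hpv'2 hα𝔤 ha2 hαa) (towerData_hαw (p := p) hαw) (towerData_hαπ (p := p) hαπ) hd E hmono hE hdeg
    hσ₀ hq u hu γ w hγ hθ hcoh hI hud hm hN 1 (towerData_hdegE hfd E hE hdeg)
    (towerData_hinert h𝔤0 hv hv' hvv' hw𝔤 hp.out hpv' hpv'2 hπ hα0 hα𝔤 hαf hℓ hαℓ ha2 hαa hd hdvd E hE hdeg)
    (towerData_hcount h𝔤0 hv' hvv' hw𝔤 hp.out hdeg1 hpv' hpv'2 E hdeg) x hx σ hσ ε g hε a₁ a₂ hv₁ hn₁ ha₂ L hL0 hL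

end Capstone

end Summit.BirchSwinnertonDyer.BirchSwinnertonDyer.Theorems.PrintCf2.ColemanCoinvariantTraceEllipticUnitsTowerData

end
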